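import Literature.AlgebraicTopology.CharacteristicClasses.LineCocycleEulerClass
import Literature.AlgebraicGeometry.HodgeTheory.LineBundleTopologicalChernClass
import Literature.AlgebraicGeometry.HodgeTheory.ProjectiveSpaceCoordFunProjPoint
import Literature.AlgebraicGeometry.Motives.AbelianVarietyTheoremOfCube
import Literature.AlgebraicGeometry.Motives.SegreHyperplaneClass
import Literature.AlgebraicGeometry.Motives.ProjectiveSpaceLinearSubspaceSection
import HarnessLib

/-!
# The topological Euler class of `𝒪(-1)` along a morphism `Ψ : X ⟶ ℙᴷ_ℂ`: it is pulled back from the tautological cocycle, and it is non-zero on `ℙᴷ(ℂ)`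

Family `hodge`, layer `Literature/AlgebraicGeometry/HodgeTheory`, namespace `Literature.AlgebraicGeometry.HodgeTheory`.  THEOREMS ONLY
(no definition, no named fact, no instance).  For a morphism `Ψ : X ⟶ ℙᴷ_ℂ` from an integral `ℂ`-scheme with generating sections
`Ψ^*x_a` in chart form (★ `GeneratingSections.affineChartData Ψ`, Hartshorne II Thm. 7.1) and the HYPERPLANE DIVISOR `D_Ψ = (Ψ^*x_j)`
(★ `GeneratingSections.divisor`, local equations `x_j/x_a` on `Ψ⁻¹D₊(x_a)`), the NEGATIVE divisor `-D_Ψ` (★ `CartierDivisor.neg`) has the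
algebraic line bundle `𝒪_X(-D_Ψ) = Ψ^*𝒪(-1)`, whose continuous line cocycle on `X(ℂ)` (★ `UnitCocycle.complexCore` of
★ `CartierDivisor.toUnitCocycle`) has transition functions the affine coordinates `Ψ^*(x_b/x_a)` read at complex points
(`coordChange_complexCore_toUnitCocycle_neg_divisor`; Griffiths–Harris p. 145: the universal bundle `J = [-H]` has the cocycle
`z_b/z_a`).  Consequences, on the real carriers `H²(–(ℂ); R)` for every coefficient ring `R`:

* **`coreEulerClass_neg_divisor_eq_map_tautological`** — `e(𝒪_X(-D_Ψ)^top) = (projPoint⁻¹ ∘ Ψ(ℂ))^* e(γ¹(ℂ^{K+1}))`: the cocycle is a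
  refinement (index map `x ↦ x_{a(x)}`) of the induced cocycle of the tautological cocycle ★ `tautologicalLineCore ℂ ℂ^{K+1}` of
  `ℙ(ℂ^{K+1})` along Serre's comparison `projPoint⁻¹ : ℙᴷ(ℂ) → ℙ(ℂ^{K+1})` composed with `Ψ(ℂ)` (★ `coordFun_eq_div_of_map_eq_projPoint_mk`
  reads both transition functions as `z_b/z_a`; ★ `coreEulerClass_eq_of_refinement`, ★ `coreEulerClass_pullbackCore`);
* **`coreEulerClass_neg_divisor_eq_map`** — NATURALITY: `e(𝒪_X(-D_Ψ)^top) = Ψ(ℂ)^* e(𝒪_{ℙᴷ}(-D_𝟙)^top)` for the hyperplane divisor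
  `D_𝟙` of `ℙᴷ` itself (any chart index);
* **`coreEulerClass_neg_divisor_projectiveSpace_ne_zero`** — `e(𝒪_{ℙᴷ}(-D_𝟙)^top)(1) ≠ 0` in `H²(ℙᴷ(ℂ); ℂ)` for `K ≥ 1`
  (★ `tautEuler_eq_coreEulerClass_tautologicalLineCore` + ★ `SegreHyperplaneClass.tautEuler_ne_zero`, Milnor–Stasheff Thm. 14.4, through the
  homeomorphism `projPoint`).

Cell pointer: `hodgecm-mathlib` (U)-lane, leaf (T2½) file (C); consumer: the top ↔ Chern–Weil line bridge (file (D)) and the (N3-core)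
assembler.  HC_CM is proved only modulo the 7 printed citations until rung 0 closes, and this file discharges none of them.

## References
* [Hartshorne1977] R. Hartshorne, *Algebraic Geometry* (1977), II Thm. 7.1 (a) (p. 150), II.7 (divisor of a section, p. 157).
* [GriffithsHarris1978] P. Griffiths, J. Harris, *Principles of Algebraic Geometry* (1978), Ch. 1 §1 pp. 144–145 (`J = [-H]`).
* [Hirzebruch1966] F. Hirzebruch, *Topological Methods in Algebraic Geometry*, 3rd ed. (1966), §4.2 (the cocycle `zᵢ/zⱼ` of `η_n⁻¹`).
* [MilnorStasheff1974] J. Milnor, J. Stasheff, *Characteristic Classes* (1974), §14 Thm. 14.4.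
* [SerreGAGA1956] J.-P. Serre, GAGA, Ann. Inst. Fourier 6 (1956), §2 n°5 (`projPoint`).
-/

set_option autoImplicit false

noncomputable section

open CategoryTheory AlgebraicGeometry TopologicalSpace Opposite Bundle
open scoped LinearAlgebra.Projectivization
open Literature.AlgebraicGeometry.Motives Literature.AlgebraicGeometry.Motives.AlgPoints Literature.AlgebraicGeometry.Motives.RatFn
  Literature.AlgebraicGeometry.Motives.AnalytificationKaehler Literature.AlgebraicGeometry.Modules
  Literature.AlgebraicTopology.CharacteristicClasses Literature.AlgebraicTopology.SingularHomology
  Literature.NumberTheory.Transcendental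

namespace Literature.AlgebraicGeometry.HodgeTheory

/-! ### §1 Transition functions of a hyperplane divisor and of its negative, read at complex points -/

section TransFun

variable {X : SchemeOver ℂ} [IsIntegral X.left]

/-- Values version of an identity in `K(X)` (two sections over opens containing `P`). [folklore] -/
private theorem evalOrZero_congr_of_ofSection_eq' {O₁ O₂ : X.left.Opens} (s₁ : Γ(X.left, O₁)) (s₂ : Γ(X.left, O₂))
    {P : ComplexPoints X} (h₁ : P.pt ∈ O₁) (h₂ : P.pt ∈ O₂)
    (H : ofSection (genericPoint_mem_of_mem h₁) s₁ = ofSection (genericPoint_mem_of_mem h₂) s₂) :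
    evalOrZero O₁ s₁ P = evalOrZero O₂ s₂ P := by
  have hO : P.pt ∈ O₁ ⊓ O₂ := ⟨h₁, h₂⟩
  rw [← evalOrZero_map_homOfLE (inf_le_left : O₁ ⊓ O₂ ≤ O₁) s₁ hO,
    ← evalOrZero_map_homOfLE (inf_le_right : O₁ ⊓ O₂ ≤ O₂) s₂ hO]
  congr 1
  refine section_ext fun hg ↦ ?_
  simp only [ofSection_map]
  exact H

variable {ι : Type} (G : GeneratingSections ι X.left) (j : ι) (hj : genericPoint X.left ∈ G.U j)

/-- **The transition functions of the divisor `D = (s_j)` of a generating section are the ratios**: at a complex point of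
`U_a ∩ U_b`, `(x_j/x_a)/(x_j/x_b) (P) = (s_b/s_a)(P) = ratio a b (P)` (Hartshorne II.7, divisor of a section; read on `X(ℂ)`).
[cite: Hartshorne1977, II.7 (p. 157, divisor of zeros) and Prop. 7.7 (a)] -/
theorem evalOrZero_transFun_divisor (a b : (G.divisor j hj).ι) {P : ComplexPoints X} (ha : P.pt ∈ G.U a.down.1)
    (hb : P.pt ∈ G.U b.down.1) :
    evalOrZero ((G.divisor j hj).U a ⊓ (G.divisor j hj).U b) ((G.divisor j hj).transFun a b) P =
      evalOrZero (G.U a.down.1) (G.ratio a.down.1 b.down.1) P := by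
  refine evalOrZero_congr_of_ofSection_eq' ((G.divisor j hj).transFun a b) (G.ratio a.down.1 b.down.1) (P := P)
    (show P.pt ∈ (G.divisor j hj).U a ⊓ (G.divisor j hj).U b from ⟨ha, hb⟩) ha ?_
  rw [CartierDivisor.ofSection_transFun]
  change G.ratioFn a.down.1 j a.down.2 / G.ratioFn b.down.1 j b.down.2 = G.ratioFn a.down.1 b.down.1 _
  rw [div_eq_iff (G.ratioFn_ne_zero _ j b.down.2 hj), G.ratioFn_mul_ratioFn]

/-- **The transition functions of the NEGATIVE divisor `-D`, `D = (s_j)`**: `((x_j/x_a)⁻¹/(x_j/x_b)⁻¹)(P) = ratio b a (P)` — the cocycle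
of `𝒪_X(-D) = Ψ^*𝒪(-1)` (Griffiths–Harris: `J = [-H]`). [cite: GriffithsHarris1978, Ch. 1 §1 pp. 144–145]
[cite: Hartshorne1977, II.7 (p. 157, divisor of zeros) and Prop. 7.7 (a)] -/
theorem evalOrZero_transFun_neg_divisor (a b : (G.divisor j hj).ι) {P : ComplexPoints X} (ha : P.pt ∈ G.U a.down.1)
    (hb : P.pt ∈ G.U b.down.1) :
    evalOrZero ((-G.divisor j hj).U a ⊓ (-G.divisor j hj).U b) ((-G.divisor j hj).transFun a b) P =
      evalOrZero (G.U b.down.1) (G.ratio b.down.1 a.down.1) P := by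
  rw [← evalOrZero_transFun_divisor G j hj b a hb ha]
  refine evalOrZero_congr_of_ofSection_eq' _ _ (P := P)
    (show P.pt ∈ (-G.divisor j hj).U a ⊓ (-G.divisor j hj).U b from ⟨ha, hb⟩)
    (show P.pt ∈ (G.divisor j hj).U b ⊓ (G.divisor j hj).U a from ⟨hb, ha⟩) ?_
  rw [CartierDivisor.ofSection_transFun, CartierDivisor.ofSection_transFun, CartierDivisor.neg_f, CartierDivisor.neg_f, inv_div_inv]

end TransFun

/-! ### §2 The continuous cocycle of `𝒪_X(-D_Ψ)` on `X(ℂ)` has the affine coordinates as transition functions -/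

section NegDivisor

variable {K : ℕ} {X : SchemeOver ℂ} [IsIntegral X.left] (Ψ : X ⟶ projectiveSpace K ℂ) (j : Fin (K + 1))
  (hj : genericPoint X.left ∈ (GeneratingSections.affineChartData Ψ).U j)

/-- **The cocycle of `𝒪_X(-D_Ψ)` read on `X(ℂ)`**: the transition of ★ `UnitCocycle.complexCore` of `(-D_Ψ).toUnitCocycle` from the chart
at `x` to the chart at `y` is multiplication by the affine coordinate `Ψ^*(x_{a(y)}/x_{a(x)})(P)` (`a(x)` the chart index of `D_Ψ` at `x`;
★ `coordFun`). [cite: GriffithsHarris1978, Ch. 1 §1 pp. 144–145] [cite: Hartshorne1977, II Thm. 7.1 (a) (p. 150)] -/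
theorem coordChange_complexCore_toUnitCocycle_neg_divisor (x y : X.left) {P : ComplexPoints X}
    (hP : P.pt ∈ (-(GeneratingSections.affineChartData Ψ).divisor j hj).toUnitCocycle.U x ⊓
      (-(GeneratingSections.affineChartData Ψ).divisor j hj).toUnitCocycle.U y) :
    (-(GeneratingSections.affineChartData Ψ).divisor j hj).toUnitCocycle.complexCore.coordChange x y P 1 =
      coordFun Ψ id (((GeneratingSections.affineChartData Ψ).divisor j hj).chartIdx x).down.1 P
        (((GeneratingSections.affineChartData Ψ).divisor j hj).chartIdx y).down.1 := by
  rw [UnitCocycle.complexCore_coordChange_apply, mul_one, CartierDivisor.toUnitCocycle_gInf]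
  change evalOrZero ((-(GeneratingSections.affineChartData Ψ).divisor j hj).U
      ((-(GeneratingSections.affineChartData Ψ).divisor j hj).chartIdx y) ⊓
      (-(GeneratingSections.affineChartData Ψ).divisor j hj).U ((-(GeneratingSections.affineChartData Ψ).divisor j hj).chartIdx x))
    ((X.left.presheaf.map (homOfLE (le_refl _)).op)
      ((-(GeneratingSections.affineChartData Ψ).divisor j hj).transFun
        ((-(GeneratingSections.affineChartData Ψ).divisor j hj).chartIdx y)
        ((-(GeneratingSections.affineChartData Ψ).divisor j hj).chartIdx x))) P = _
  rw [evalOrZero_map_homOfLE (le_refl _) _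
      (show P.pt ∈ (-(GeneratingSections.affineChartData Ψ).divisor j hj).U
          ((-(GeneratingSections.affineChartData Ψ).divisor j hj).chartIdx y) ⊓
        (-(GeneratingSections.affineChartData Ψ).divisor j hj).U ((-(GeneratingSections.affineChartData Ψ).divisor j hj).chartIdx x)
        from ⟨hP.2, hP.1⟩)]
  exact evalOrZero_transFun_neg_divisor (GeneratingSections.affineChartData Ψ) j hj
    ((-(GeneratingSections.affineChartData Ψ).divisor j hj).chartIdx y) ((-(GeneratingSections.affineChartData Ψ).divisor j hj).chartIdx x)
    hP.2 hP.1

variable (R : Type) [CommRing R] [T2Space (ComplexPoints X)] [ParacompactSpace (ComplexPoints X)]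

/-- **`e(𝒪_X(-D_Ψ)^top)(m) = (projPoint⁻¹ ∘ Ψ(ℂ))^* e(γ¹(ℂ^{K+1}))(m)`**: the continuous cocycle of `𝒪_X(-D_Ψ)` on `X(ℂ)` refines (index map
`x ↦` the coordinate functional `x_{a(x)}`) the cocycle induced from the TAUTOLOGICAL cocycle ★ `tautologicalLineCore ℂ ℂ^{K+1}` of
`ℙ(ℂ^{K+1})` along `projPoint⁻¹ ∘ Ψ(ℂ)` — both transition functions read `z_{a(y)}/z_{a(x)}` at `Ψ(ℂ)(P) = projPoint [z]`
(★ `coordFun_eq_div_of_map_eq_projPoint_mk`, ★ `tautologicalLineCore_coordChange_apply`); then ★ `coreEulerClass_eq_of_refinement` and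
★ `coreEulerClass_pullbackCore`. [cite: GriffithsHarris1978, Ch. 1 §1 pp. 144–145] [cite: Hirzebruch1966, §4.2] -/
theorem coreEulerClass_neg_divisor_eq_map_tautological (m : R) :
    eulerClass ℂ (-(GeneratingSections.affineChartData Ψ).divisor j hj).toUnitCocycle.complexCore.Fiber (Module.finrank_self ℂ) R m =
      singularCohomology.map R R
        (((isHomeomorph_projPoint K).homeomorph.symm : C(ComplexPoints (projectiveSpace K ℂ), ℙ ℂ (Fin (K + 1) → ℂ))).comp
          (AlgPoints.mapContinuous (L := ℂ) Ψ)) 2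
        (eulerClass ℂ (tautologicalLineCore ℂ (Fin (K + 1) → ℂ)).Fiber (Module.finrank_self ℂ) R m) := by
  set G := GeneratingSections.affineChartData Ψ with hG
  set D := G.divisor j hj with hD
  set h := (isHomeomorph_projPoint K).homeomorph with hh
  set F : C(ComplexPoints X, ℙ ℂ (Fin (K + 1) → ℂ)) :=
    (h.symm : C(ComplexPoints (projectiveSpace K ℂ), ℙ ℂ (Fin (K + 1) → ℂ))).comp (AlgPoints.mapContinuous (L := ℂ) Ψ) with hF
  -- `Ψ(ℂ)` lies over `F` through `projPoint`
  have hover : ∀ P : ComplexPoints X, AlgPoints.map Ψ (id P) = projPoint K (F P) := fun P ↦ by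
    change AlgPoints.map Ψ P = projPoint K (h.symm (AlgPoints.map Ψ P))
    exact (h.apply_symm_apply (AlgPoints.map Ψ P)).symm
  have hrep : ∀ P : ComplexPoints X, F P = Projectivization.mk ℂ (F P).rep (F P).rep_nonzero := fun P ↦ (Projectivization.mk_rep _).symm
  rw [← coreEulerClass_pullbackCore (tautologicalLineCore ℂ (Fin (K + 1) → ℂ)) F R m]
  refine coreEulerClass_eq_of_refinement (Z₁ := (-D).toUnitCocycle.complexCore)
    (Z₂ := (tautologicalLineCore ℂ (Fin (K + 1) → ℂ)).pullbackCore F)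
    (j := fun x ↦ ContinuousLinearMap.proj (R := ℂ) (φ := fun _ : Fin (K + 1) ↦ ℂ) (D.chartIdx x).down.1) R ?_ ?_ m
  · -- chart compatibility: `P ∈ Ψ⁻¹D₊(x_a)(ℂ)` ⇒ `F P ∈ U_{x_a}`
    intro x P hP
    have hPa : id P ∈ chartDom Ψ id (D.chartIdx x).down.1 := hP
    have hz : (F P).rep (D.chartIdx x).down.1 ≠ 0 :=
      (mem_chartDom_iff_of_map_eq_projPoint_mk Ψ id F hover (fun P ↦ (F P).rep) (fun P ↦ (F P).rep_nonzero) hrep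
        (D.chartIdx x).down.1 P).1 hPa
    change F P ∈ chartDomain ((ContinuousLinearMap.proj (R := ℂ) (φ := fun _ : Fin (K + 1) ↦ ℂ) (D.chartIdx x).down.1 :
      StrongDual ℂ (Fin (K + 1) → ℂ)) : Module.Dual ℂ (Fin (K + 1) → ℂ))
    rw [hrep P, mk_mem_chartDomain_iff]
    exact hz
  · -- same transition functions: `Ψ^*(x_{a(y)}/x_{a(x)})(P) = z_{a(y)}/z_{a(x)}`
    intro x y P hP
    have hzx : (F P).rep (D.chartIdx x).down.1 ≠ 0 :=
      (mem_chartDom_iff_of_map_eq_projPoint_mk Ψ id F hover (fun P ↦ (F P).rep) (fun P ↦ (F P).rep_nonzero) hrep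
        (D.chartIdx x).down.1 P).1 hP.1
    rw [coordChange_complexCore_toUnitCocycle_neg_divisor Ψ j hj x y hP,
      coordFun_eq_div_of_map_eq_projPoint_mk Ψ id F hover (fun P ↦ (F P).rep) (fun P ↦ (F P).rep_nonzero) hrep hzx,
      VectorBundleCore.pullbackCore_coordChange]
    conv_rhs => rw [hrep P]
    rw [tautologicalLineCore_coordChange_apply, mul_one]
    rfl

/-- **Naturality: `e(𝒪_X(-D_Ψ)^top) = Ψ(ℂ)^* e(𝒪_{ℙᴷ}(-D_𝟙)^top)`** for the hyperplane divisor `D_𝟙 = (x_{j'})` of `ℙᴷ` itself (any `j'`).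
[cite: HusemollerFibreBundles1994, Ch. 17 Prop. 3.3] [cite: GriffithsHarris1978, Ch. 1 §1 pp. 144–145] -/
theorem coreEulerClass_neg_divisor_eq_map (j' : Fin (K + 1))
    (hj' : genericPoint (projectiveSpace K ℂ).left ∈ (GeneratingSections.affineChartData (𝟙 (projectiveSpace K ℂ))).U j')
    [T2Space (ComplexPoints (projectiveSpace K ℂ))] [ParacompactSpace (ComplexPoints (projectiveSpace K ℂ))] (m : R) :
    eulerClass ℂ (-(GeneratingSections.affineChartData Ψ).divisor j hj).toUnitCocycle.complexCore.Fiber (Module.finrank_self ℂ) R m =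
      singularCohomology.map R R (AlgPoints.mapContinuous (L := ℂ) Ψ) 2
        (eulerClass ℂ (-(GeneratingSections.affineChartData (𝟙 (projectiveSpace K ℂ))).divisor j' hj').toUnitCocycle.complexCore.Fiber
          (Module.finrank_self ℂ) R m) := by
  rw [coreEulerClass_neg_divisor_eq_map_tautological Ψ j hj R m,
    coreEulerClass_neg_divisor_eq_map_tautological (𝟙 (projectiveSpace K ℂ)) j' hj' R m, AlgPoints.mapContinuous_id,
    ContinuousMap.comp_id, singularCohomology.map_comp]
  rfl

end NegDivisor

/-! ### §3 On `ℙᴷ(ℂ)`: the class is non-zero over `ℂ` -/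

section ProjectiveSpace

variable {K : ℕ} (j : Fin (K + 1))
  (hj : genericPoint (projectiveSpace K ℂ).left ∈ (GeneratingSections.affineChartData (𝟙 (projectiveSpace K ℂ))).U j)
  [T2Space (ComplexPoints (projectiveSpace K ℂ))] [ParacompactSpace (ComplexPoints (projectiveSpace K ℂ))]

/-- **`e(𝒪_{ℙᴷ}(-D_𝟙)^top)(1) ≠ 0` in `H²(ℙᴷ(ℂ); ℂ)` for `K ≥ 1`**: it is the transport along the homeomorphism `projPoint⁻¹` of the Euler class
of the tautological cocycle of `ℙ(ℂ^{K+1})`, i.e. of `e(γ¹)` (★ `tautEuler_eq_coreEulerClass_tautologicalLineCore`), which is non-zero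
(★ `tautEuler_ne_zero`, Milnor–Stasheff Thm. 14.4). [cite: MilnorStasheff1974, §14 Thm. 14.4] [cite: SerreGAGA1956, §2 n°5] -/
theorem coreEulerClass_neg_divisor_projectiveSpace_ne_zero (hK : 1 ≤ K) :
    eulerClass ℂ (-(GeneratingSections.affineChartData (𝟙 (projectiveSpace K ℂ))).divisor j hj).toUnitCocycle.complexCore.Fiber
      (Module.finrank_self ℂ) ℂ 1 ≠ 0 := by
  rw [coreEulerClass_neg_divisor_eq_map_tautological (𝟙 (projectiveSpace K ℂ)) j hj ℂ 1, AlgPoints.mapContinuous_id,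
    ContinuousMap.comp_id, ← tautEuler_eq_coreEulerClass_tautologicalLineCore]
  intro h0
  apply SegreHyperplaneClass.tautEuler_ne_zero hK
  have hinj : Function.Injective (singularCohomology.map ℂ ℂ
      ((isHomeomorph_projPoint K).homeomorph.symm : C(ComplexPoints (projectiveSpace K ℂ), ℙ ℂ (Fin (K + 1) → ℂ))) 2) :=
    (singularCohomology.mapIso ℂ ℂ (isHomeomorph_projPoint K).homeomorph.symm 2).toLinearEquiv.injective
  exact hinj (h0.trans (map_zero _).symm)

end ProjectiveSpace

end Literature.AlgebraicGeometry.HodgeTheory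

end
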